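import Summits.HodgeConjecture.HodgeConjecture.Theses.PadicSemiregularLift
import Summits.HodgeConjecture.HodgeConjecture.Theorems.PadicSemiregularLiftFormalLiftingFromClassLiftingGlue
import Summits.HodgeConjecture.HodgeConjecture.Theorems.PadicSemiregularLiftFormalLiftingFromClassLiftingPicKernelLift
import Summits.HodgeConjecture.HodgeConjecture.Theorems.PadicSemiregularLiftFormalLiftingFromClassLiftingHuAssembly
import Literature.AlgebraicGeometry.KTheory.HuHypercohomologyCriteria
import Literature.AlgebraicGeometry.Crystalline.StaircaseIntegralDegeneration
import Literature.AlgebraicGeometry.Crystalline.HuComplexesHighWeight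
import Literature.AlgebraicGeometry.Crystalline.HuComplexesDivision
/-!
# Skeleton — crux stmt-HodgeConjecture-13825 `FormalLiftingFromClassLifting`, line `IdeatorFiveSketch`
# (porteous-rank-one-isation, reshaped "weight-one-first"; lead prover-line-stmt-HodgeConjecture-13825-c1-0)

The crux (P1a of route `PadicSemiregularLift`): on a Hodge-torsion-free smooth projective `𝒳/W(k)`
(`d + 6 < p`, `d ≤ 3 ∨ Ω¹` free), a finite locally free `E₁` on `X_k` satisfying (⋆)
CLASS-LIFTS-IMPLY-OBJECT-LIFTS whose rational class pro-lifts, lifts formally.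

Composition (sorry-free here): by the landed reduction `Glue.liftsFormally_of_stepClassLifting`
(p76799) it suffices that every finite-level finite locally free lift `F` of `E₁` to `X_{n+1}` has
`[F] ∈ im(K₀(X_{n+2}) → K₀(X_{n+1}))` (STEP CLASS LIFTING). We factor this through the DETERMINANT:

* WEIGHT ONE (the determinant class `det[F] ∈ Ȟ¹(X_{n+1}, 𝒪^×)` of every such `F` extends to
  `X_{n+2}`; `detClass_extends`, PROVED here from the stubs): (i) `det` of an integral multiple of
  the rational pro-class gives level-wise lifts of `det[E₁]^N` (`detPow_lifts_all_levels`, proved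
  here over `Negative.exists_int_multiple_lifts_all_levels`, `KZero.det`, `KZero.det_map`);
  (ii) (2_Pic) KERNEL LINE-BUNDLE CLASSES LIFT (`stub_picKernelLift`, the lead's stub: classes in
  `ker(Ȟ¹(X_{n+1},𝒪^×) → Ȟ¹(X_k,𝒪^×))` extend one step), assembled from three worker-sized pieces —
  `stub_h1MapSurjective` (`H¹(𝒳,𝒪) ↠ H¹` of any quotient `𝒪/q` when `H²(𝒳,𝒪)` has no `q`-torsion:
  the `Ext` long exact sequence), `stub_cechOneCocycleLift` (Čech `1`-cocycles lift along a sheaf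
  map that is onto on `H¹`, after refinement — the injectivity/surjectivity of `Ȟ¹ → H¹`,
  Hartshorne III 4.4/Ex. 4.4), `stub_truncatedExpLog` (the power-map logarithm `u ↦ (u^{p^M}-1)/p^{M+1}`:
  `1 + p𝒪/p^{M+1} ≅ 𝒪/p^M`, an integer polynomial bijective mod `p^M`, `p` odd); (iii) TEICHMÜLLER TRANSPORT
  (`stub_teichmuellerTransport`): if `c^{p^e N}|_{X_k}` lifts to `X_{m+e+2}` (`p ∤ N`) and (2_Pic)
  holds at level `m+e+1`, then `c ∈ Ȟ¹(X_{m+1},𝒪^×)` extends to `X_{m+2}` — the `p^e`-th power of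
  lifted transition functions moves the defect from `1 + p^{m+1}𝒪` to `1 + p^{m+e+1}𝒪` with the SAME
  reduced obstruction cochain (valid for `p ≥ 3`), so the obstruction of `c` is that of a class
  which differs from a liftable class by a kernel class.
* RESIDUAL (`stub_stepClassLiftingFromDetClass`, the card's rank-one-isation / the (1_K)∧(2_K)
  content for ranks `≥ 2`; carrier-blocked today): under the hypotheses of the crux, a finite-level
  lift `F` of `E₁` whose determinant class extends has `[F]` extending.

No `K`-theory of thickenings and no crystalline input enter the weight-one part; for `E₁` of rank
one it is the whole crux (`RankOne.formalLiftingFromClassLifting_of_hasRank_one`, tree).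

RESHAPE (lead c2-0, cycle 2 of the line): S6 is DERIVED from the landed conditional
`HuLine.stepClassLifting_of_hu` (p107875), whose four inputs are the two named facts
`stub_huKZeroKernelPresentation`, `stub_huKZeroLiftingCriterion` (claims of arXiv:2507.12458) and the two
coherent lattice statements (S) (odd reductions onto, `1 ≤ r < p`) and (T) (even compatible families killed
by `L ≠ 0` vanish, `1 ≤ r < d`).

RESHAPE (lead c3-0, cycle 3 of the line): (S) and (T) are now DERIVED in this file
(`oddReductionsSurjective`, `evenFamiliesTorsionFree`) from ONE further named fact, Deligne's degeneration of
Hodge–de Rham modulo torsion (`stub_hodgeDeRhamDegeneratesModTorsion`), through the route seats' landed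
staircase chain (`Crystalline.staircase_torsionFree_hyperExt_stupidTruncLE_weight` p110084,
`KTheory/HuHypercohomologyCriteria` p115294, `Crystalline/HuComplexesHighWeight` p111643,
`Crystalline/HuComplexesDivision` p115322). The open stubs are EXACTLY the three named facts H1, H2, H3;
everything else of the line is proved here or landed. (For `d ≤ 2` H3 is not needed: `…HuLowDimension`,
p115874; for rank one nothing is: `RankOne.formalLiftingFromClassLifting_of_hasRank_one`, p114701.)
-/

set_option linter.dupNamespace false

-- hyper-Ext smallness instances for the truncated staircase complexes go through `IsStrictlyGE 0 ⇒ IsGE 0`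
-- (as in `Crystalline/HodgeDeRhamDegeneration`, `KTheory/HuHypercohomologyCriteria`); give the search room.
set_option synthInstance.maxHeartbeats 200000

namespace Summit.HodgeConjecture.HodgeConjecture.Cruxes.FormalLiftingFromClassLifting.WeightOne

open CategoryTheory AlgebraicGeometry Limits Opposite TopologicalSpace
open Literature.AlgebraicGeometry Literature.AlgebraicGeometry.Motives
open Literature.AlgebraicGeometry.Motives.WittScheme
open Literature.AlgebraicGeometry.Modules (CechPic UnitCocycle detClass detClass_pullback)
open Summit.HodgeConjecture.HodgeConjecture.Theses.PadicSemiregularLift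
open Summit.HodgeConjecture.HodgeConjecture.Theorems.FormalLiftingFromClassLifting
open Literature.Algebra.Homology (HyperExt)

noncomputable section

universe u

/-! ## Stubs

S1 `stub_h1MapSurjective` (p99672), S2 `stub_cechOneCocycleLift` (p100161), S3 `stub_truncatedExpLog`
(p99743), T `stub_towerDatumCocycle` (p104213), P `stub_kernelPresentation`, S4 `stub_picKernelLift`
((2_Pic)), S5 `stub_teichmuellerTransport` (p103933) and the weight-one engine `detClass_extends` are
LANDED under `Summits/HodgeConjecture/HodgeConjecture/Theorems/PadicSemiregularLiftFormalLiftingFromClassLifting*.lean`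
(namespace `Summit.HodgeConjecture.HodgeConjecture.Theorems.FormalLiftingFromClassLifting.WeightOne`,
imported above through `…PicKernelLift`). The residual S6 is derived below from the three registered
stubs H1, H2, H3 (named facts) through the derived lattice statements (S)/(T). -/

/-! ### The residual of S6, reshaped (leads c2-0 / c3-0): S6 in ranks `≥ 2` is the conclusion of the
landed conditional `HuLine.stepClassLifting_of_hu` (p107875); its inputs are the two Hu NAMED FACTS H1/H2
(claims of X. Hu, arXiv:2507.12458, vendored in `Literature/AlgebraicGeometry/KTheory/HuInfinitesimalKZero.lean`)
and the lattice statements (S)/(T), derived below from the third NAMED FACT H3 (Deligne). S6 itself is then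
PROVED from them; the determinant hypothesis of S6 is not needed for this derivation (it is what made the
rank-one case unconditional: `RankOne.formalLiftingFromClassLifting_of_hasRank_one`). -/

/-- **Stub H2 (named fact: X. Hu's kernel presentation, arXiv:2507.12458 Cor. 10.5 (i) + Prop. 9.6 (ii)).**
The tree's claim `KTheory.HuKZeroKernelPresentation` (`@[claim … under-review]`); discharging it means
formalising §§8–10 of the source (relative Chern character onto the kernel of `K₀(X_n) → K₀(X_m)`). -/
theorem stub_huKZeroKernelPresentation : KTheory.HuKZeroKernelPresentation := by
  sorry

/-- **Stub H1 (named fact: X. Hu's `K₀`-lifting criterion, arXiv:2507.12458 Thm. 1.2 = Prop. 11.1 (i) +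
Prop. 9.6 (i)).** The tree's claim `KTheory.HuKZeroLiftingCriterion` (`@[claim … under-review]`). -/
theorem stub_huKZeroLiftingCriterion : KTheory.HuKZeroLiftingCriterion := by
  sorry

/-- **Stub H3 (named fact: degeneration of the Hodge–de Rham spectral sequence modulo torsion for
smooth proper `𝒳/W(k)`, Deligne 1968, Thm. 5.5 (ii)).** The tree's `Crystalline.HodgeDeRhamDegeneratesModTorsion`
(`Literature/AlgebraicGeometry/Crystalline/HodgeDeRhamDegeneration.lean`, `[cite: Deligne1968]`): every connecting
map of the stupid (Hodge) filtration of the algebraic de Rham complex of `𝒳` has torsion image. A published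
THEOREM (char-`0` Hodge theory / Deligne–Illusie), not a claim; discharging it needs the Cartier isomorphism or
Hodge theory, neither of which has a carrier in the tree. It enters ONLY the low weights `2 ≤ r < d` of the
lattice statements (S)/(T) below (so not at all for `d ≤ 2`: `HuLowDimension`, p115874). -/
theorem stub_hodgeDeRhamDegeneratesModTorsion : Crystalline.HodgeDeRhamDegeneratesModTorsion := by
  sorry

/-- **LS (lattice lemma (S): odd level transitions of Hu's hypercohomology are onto) — DERIVED (lead c3-0,
cycle 3) from H3.** For every model in the scope of the crux and `1 ≤ r < p`, the reduction
`ℍ^{2r-1}(p^{r,1}_{r,N+3}Ω•) → ℍ^{2r-1}(p^{r,1}_{r,N+2}Ω•)` is surjective (verbatim the third hypothesis of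
`HuLine.stepClassLifting_of_hu`). Weights `r ≥ d`: unconditional, by the support of Hu's complexes on the
special fibre (`Crystalline.huHReduce_odd_surjective_of_lowWeights`, p111643). Weights `1 ≤ r < d`: both groups
are quotients of `ℍ^{2r-1}(σ≤(r-1) p^{(r-•)}Ω•)` as soon as `ℍ^{2r}(σ≤(r-1) p^{(r-•)(N+2)}Ω•)` has no `p`-torsion
(`KTheory.HuStaircase.huHReduce_surjective_of_torsionFree`, p115294), and that torsion-freeness is the crux's
torsion-free Hodge cohomology + H3 (`Crystalline.staircase_torsionFree_hyperExt_stupidTruncLE_weight`, p110084).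
Projectivity and `d + 6 < p` are not used. -/
theorem oddReductionsSurjective :
    ∀ (p : ℕ) [Fact p.Prime] (k : Type) [Field k] [CharP k p] [PerfectRing k p] (d : ℕ)
      (𝒳 : SchemeOver (WittVector p k)), IsSmoothProperModel d 𝒳 →
      Crystalline.IsProjectiveOverRing 𝒳 → d + 6 < p →
      (∀ (b : ℕ) (x : structureSheafCohomology 𝒳.left b), (p : ℤ) • x = 0 → x = 0) →
      (∀ (b : ℕ) (x : hodgeCohomologyOne 𝒳 b), (p : ℤ) • x = 0 → x = 0) →
      (d ≤ 3 ∨ Nonempty (cotangentSheaf 𝒳 ≅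
        SheafOfModules.free (R := 𝒳.left.ringCatSheaf) (Fin d))) →
      ∀ (N r : ℕ), 1 ≤ r → r < p →
        Function.Surjective (KTheory.huHReduce p k 𝒳 r 1 (Nat.le_succ (N + 2)) (2 * (r : ℤ) - 1)) := by
  intro p _ k _ _ _ d 𝒳 h𝒳 _ _ hO hΩ hdisj N r hr _
  have hp0 : (p : ℤ) ≠ 0 := by exact_mod_cast (Fact.out : p.Prime).ne_zero
  refine Crystalline.huHReduce_odd_surjective_of_lowWeights h𝒳 (fun N' r' hr' hrd' => ?_) N r hr
  exact KTheory.HuStaircase.huHReduce_surjective_of_torsionFree p k 𝒳 r' (show 1 ≤ N' + 2 by omega)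
    (Nat.le_succ (N' + 2)) (2 * (r' : ℤ) - 1) (2 * (r' : ℤ)) (by omega)
    (fun x hx => Crystalline.staircase_torsionFree_hyperExt_stupidTruncLE_weight 𝒳
      stub_hodgeDeRhamDegeneratesModTorsion (hA := fun n _ => Literature.Algebra.Homology.hasHyperExt_of_isGE _ _ n)
      h𝒳 hO hΩ hdisj r' (N' + 2) hrd' (2 * (r' : ℤ)) (p : ℤ) hp0 x hx)

/-- **LT (lattice lemma (T): even compatible families killed by a non-zero integer vanish) — DERIVED (lead
c3-0, cycle 3) from H3.** For every model in the scope of the crux and `1 ≤ r < d`, a family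
`o_N ∈ ℍ^{2r}(p^{r,1}_{r,N+2}Ω•)` compatible under the reductions with `L • o = 0`, `L ≠ 0`, is zero (verbatim the
fourth hypothesis of `HuLine.stepClassLifting_of_hu`; Bloch–Esnault–Kerz Rem. 35 (2) / Thm. 36 (1)). Proof: the
`p`-adic tower algebra `KTheory.HuStaircase.huH_family_eq_zero` (p115294) on `H = ℍ^{2r}(σ≤(r-1) p^{(r-•)}Ω•)`, whose
three inputs are (i) `H` has no `p`-torsion and (ii) the projections `H → ℍ^{2r}(p^{r,1}_{r,N+2})` are onto (from the
torsion-freeness of `ℍ^{2r+1}(σ≤(r-1) p^{(r-•)(N+2)}Ω•)`, `staircaseHπ_surjective_of_torsionFree`) — both torsion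
statements being the crux's torsion-free Hodge cohomology + H3 (`Crystalline.staircase_torsionFree_hyperExt_stupidTruncLE_weight`,
p110084) — and (iii) the image of `ℍ^{2r}(σ≤ p^{(r-•)(N+2)}) → H` is divisible by `p^{N+1}`, which is the chain-level
division of the truncated inclusion by `p^{N+1}` (`Crystalline.deRhamStaircaseHatTruncMul_comp_TruncLE`,
`isIso_deRhamStaircaseHatTruncMul`, p115322; the `Ωʲ_{𝒳/W}` have no `p`-torsion for a smooth `𝒳/W(k)`).
Projectivity and `d + 6 < p` are not used. -/
theorem evenFamiliesTorsionFree :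
    ∀ (p : ℕ) [Fact p.Prime] (k : Type) [Field k] [CharP k p] [PerfectRing k p] (d : ℕ)
      (𝒳 : SchemeOver (WittVector p k)), IsSmoothProperModel d 𝒳 →
      Crystalline.IsProjectiveOverRing 𝒳 → d + 6 < p →
      (∀ (b : ℕ) (x : structureSheafCohomology 𝒳.left b), (p : ℤ) • x = 0 → x = 0) →
      (∀ (b : ℕ) (x : hodgeCohomologyOne 𝒳 b), (p : ℤ) • x = 0 → x = 0) →
      (d ≤ 3 ∨ Nonempty (cotangentSheaf 𝒳 ≅
        SheafOfModules.free (R := 𝒳.left.ringCatSheaf) (Fin d))) →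
      ∀ (r : ℕ), 1 ≤ r → r < d → ∀ (L : ℤ), L ≠ 0 →
        ∀ o : (∀ N : ℕ, KTheory.huH p k 𝒳 r 1 (N + 2) (2 * (r : ℤ))),
          (∀ N, KTheory.huHReduce p k 𝒳 r 1 (Nat.le_succ (N + 2)) _ (o (N + 1)) = o N) →
          (∀ N, L • o N = 0) → ∀ N, o N = 0 := by
  intro p _ k _ _ _ d 𝒳 h𝒳 _ _ hO hΩ hdisj r _ hrd L hL o ho hLo N
  have hp0 : (p : ℤ) ≠ 0 := by exact_mod_cast (Fact.out : p.Prime).ne_zero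
  have htf : ∀ (M : ℕ) (n : ℤ) (x : KTheory.HuStaircase.staircaseH p k 𝒳 r M n),
      (p : ℤ) • x = 0 → x = 0 := fun M n x hx =>
    Crystalline.staircase_torsionFree_hyperExt_stupidTruncLE_weight 𝒳 stub_hodgeDeRhamDegeneratesModTorsion
      (hA := fun n _ => Literature.Algebra.Homology.hasHyperExt_of_isGE _ _ n) h𝒳 hO hΩ hdisj r M hrd n (p : ℤ) hp0 x hx
  refine KTheory.HuStaircase.huH_family_eq_zero p k 𝒳 r (2 * (r : ℤ)) (htf 1 _)
    (fun N' => KTheory.HuStaircase.staircaseHπ_surjective_of_torsionFree p k 𝒳 r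
      (show 1 ≤ N' + 2 by omega) (2 * (r : ℤ)) (2 * (r : ℤ) + 1) rfl (htf (N' + 2) _))
    (fun N' x => ?_) L hL o ho hLo N
  -- (iii): the truncated inclusion `σ≤(r-1) p^{(r-•)(N'+2)}Ω• → σ≤(r-1) p^{(r-•)}Ω•` is `p^{N'+1}` times a
  -- chain map (through the auxiliary staircase `p^{ê}Ω•`), hence so is its effect on hypercohomology.
  haveI : ∀ j, Mono ((p : ℤ) • 𝟙 ((Crystalline.algebraicDeRhamComplex 𝒳).X j)) := fun j =>
    IsSmoothProperModel.mono_p_smul_id_algebraicDeRhamComplex_X 𝒳 d h𝒳 j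
  haveI := Crystalline.isIso_deRhamStaircaseHatTruncMul 𝒳 (p : ℤ) r 1 (N' + 2)
  obtain ⟨y, rfl⟩ := (HyperExt.map_bijective_of_isIso
    (X := Crystalline.constantSheafInt (Opens.grothendieckTopology 𝒳.left))
    (Crystalline.deRhamStaircaseHatTruncMul 𝒳 (p : ℤ) r 1 (N' + 2)) (2 * (r : ℤ))).2 x
  refine ⟨HyperExt.map (Crystalline.deRhamStaircaseHatTruncLE 𝒳 (p : ℤ) r (show 1 ≤ N' + 2 by omega))
    (2 * (r : ℤ)) y, ?_⟩
  show HyperExt.map _ _ (HyperExt.map _ _ y) = _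
  rw [← HyperExt.map_comp, Crystalline.deRhamStaircaseHatTruncMul_comp_TruncLE, HyperExt.map_zsmul_hom]
  rfl

/-- **S6 (RESIDUAL: step class lifting from the determinant class; carrier-blocked).** Under the
hypotheses of the crux, a finite-level finite locally free lift `F` of `E₁` to `X_{n+1}` whose
determinant class extends to `X_{n+2}` has `[F] ∈ im(K₀(X_{n+2}) → K₀(X_{n+1}))`. For `d ≤ 3` this is
the card's rank-one-isation (`r` general sections of `F(N)` have corank `≤ 1`; the Noether–Lefschetz
pair `(D, 𝓛)` lifts); in general it is the (1_K)∧(2_K) content of the paper proof (Bloch–Esnault–Kerz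
§8, Hu arXiv:2507.12458 Prop. 11.1) in weights `≥ 2`. Trivial for `F` of rank `≤ 1`. -/
theorem stepClassLiftingFromDetClass :
    ∀ (p : ℕ) [Fact p.Prime] (k : Type) [Field k] [CharP k p] [PerfectRing k p] (d : ℕ)
      (𝒳 : SchemeOver (WittVector p k)), IsSmoothProperModel d 𝒳 →
      Crystalline.IsProjectiveOverRing 𝒳 → d + 6 < p →
      (∀ (b : ℕ) (x : structureSheafCohomology 𝒳.left b), (p : ℤ) • x = 0 → x = 0) →
      (∀ (b : ℕ) (x : hodgeCohomologyOne 𝒳 b), (p : ℤ) • x = 0 → x = 0) →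
      (d ≤ 3 ∨ Nonempty (cotangentSheaf 𝒳 ≅ SheafOfModules.free (R := 𝒳.left.ringCatSheaf) (Fin d))) →
      ∀ (E₁ : (specialFibre 𝒳).left.Modules) (hE₁ : IsFiniteLocallyFree E₁),
        (∀ (n : ℕ) (F : (thickening 𝒳 (n + 1)).left.Modules) (hF : IsFiniteLocallyFree F),
          Nonempty ((Scheme.Modules.pullback (specialFibreToThickening 𝒳 n)).obj F ≅ E₁) →
          (∃ y : KTheory.KZero (thickening 𝒳 (n + 2)).left,
            KTheory.KZero.map (thickeningMap 𝒳 (Nat.le_succ (n + 1))) y = KTheory.KZero.of F hF) →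
          ∃ F' : (thickening 𝒳 (n + 2)).left.Modules, IsFiniteLocallyFree F' ∧
            Nonempty ((Scheme.Modules.pullback (thickeningMap 𝒳 (Nat.le_succ (n + 1)))).obj F' ≅ F)) →
        (∃ ξ : KTheory.ContinuousKZeroRat (Ideal.span {(p : WittVector p k)}) 𝒳,
          KTheory.KZeroRat.map (Crystalline.specialFibreToTower 𝒳)
            (KTheory.ContinuousKZeroRat.specialFibre (Ideal.span {(p : WittVector p k)}) 𝒳 ξ) =
            KTheory.KZeroRat.of E₁ hE₁) →
        ∀ (n : ℕ) (F : (thickening 𝒳 (n + 1)).left.Modules) (hF : IsFiniteLocallyFree F),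
          Nonempty ((Scheme.Modules.pullback (specialFibreToThickening 𝒳 n)).obj F ≅ E₁) →
          (∃ c' : CechPic (thickening 𝒳 (n + 2)).left,
            CechPic.pullback (thickeningMap 𝒳 (Nat.le_succ (n + 1))) c' = detClass hF) →
          ∃ y : KTheory.KZero (thickening 𝒳 (n + 2)).left,
            KTheory.KZero.map (thickeningMap 𝒳 (Nat.le_succ (n + 1))) y = KTheory.KZero.of F hF := by
  intro p _ k _ _ _ d 𝒳 h𝒳 hproj hp hO hΩ hd E₁ hE₁ _ hξ n F hF hFE _
  exact HuLine.stepClassLifting_of_hu 𝒳 stub_huKZeroKernelPresentation stub_huKZeroLiftingCriterion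
    h𝒳 (by omega) (oddReductionsSurjective p k d 𝒳 h𝒳 hproj hp hO hΩ hd)
    (evenFamiliesTorsionFree p k d 𝒳 h𝒳 hproj hp hO hΩ hd) hE₁ hξ n F hF hFE

/-! The weight-one engine `detClass_extends` (over S4 (2_Pic), S5 (Teichmüller transport), T, P and
`detPow_lifts_all_levels`) is LANDED (`…Theorems/PadicSemiregularLiftFormalLiftingFromClassLiftingPicKernelLift.lean`)
and used below by its full name. -/

/-! ## The crux by name -/

/-- **`FormalLiftingFromClassLifting` from the stubs**: the weight-one engine (`detClass_extends`,
over S1–S5) feeds the residual S6, which gives step class lifting for every finite-level lift of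
`E₁`; the landed reduction `Glue.liftsFormally_of_stepClassLifting` (p76799) climbs the tower with
(⋆). Flatness, separatedness and `p ≠ 2` come from smoothness, properness and `d + 6 < p`. -/
theorem FormalLiftingFromClassLifting_of : FormalLiftingFromClassLifting := by
  intro p _ k _ _ _ d 𝒳 h𝒳 hproj hp hO hΩ hdisj E₁ hE₁ hstar hξ
  haveI := h𝒳.smoothOfRelativeDimension
  haveI : Smooth 𝒳.hom := SmoothOfRelativeDimension.smooth d 𝒳.hom
  haveI := h𝒳.isProper
  have hp2 : p ≠ 2 := by omega
  refine Glue.liftsFormally_of_stepClassLifting hE₁ hstar fun n F hF hFE => ?_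
  exact stepClassLiftingFromDetClass p k d 𝒳 h𝒳 hproj hp hO hΩ hdisj E₁ hE₁ hstar hξ n F hF hFE
    (Summit.HodgeConjecture.HodgeConjecture.Theorems.FormalLiftingFromClassLifting.WeightOne.detClass_extends
      p k 𝒳 hp2 (hO 2) E₁ hE₁ hξ n F hF hFE)

end

end Summit.HodgeConjecture.HodgeConjecture.Cruxes.FormalLiftingFromClassLifting.WeightOne
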